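import Summits.Ventures.Crystal3D.Theorems.StickyWulffConstantTextureBuildMeshV7
import HarnessLib

/-!
# TB-1 brick: SMART CONSTRUCTORS for the TB interface — a tents-and-cells cover as a `RiseredCover`, and a `Mesh₇` from the NON-VACUOUS clauses only
# (lane T, crux `TextureLiminfV5`, stmt-Ventures-23912; blueprint HOME/wulff-p2/g23/TB-COVER-BLUEPRINT-g23.md step S9)

HONEST FRAMING. Venture `Summits/Ventures/Crystal3D` (cell `crystal3d-full`), route `route-Ventures-StickyWulffConstant`, helper `--supports` the
law-v5 crux `TextureLiminfV5` (stmt-Ventures-23912).  Definitions + pure logic (census-free, standard axioms).  No cover is built; F-C1 not moved.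

The binder of `stub_TB_cover` (v8.24, `CoverH`) is a `RiseredCover` (≈ 45 fields) with a `Mesh₇` (≈ 75 fields).  A cover WITHOUT crust cells, riser pieces
and gap pieces — the shape of every cover the healed constructor builds away from coherent twin steps (tents + wall cells; junk healed or unowned) — fills
most of them vacuously.  This file packages that once (the single-grain instance '…SingleGrainMesh' p745363 was the template):

* `CellCover.toRisered₀ cv` — a tents-and-cells cover as a `RiseredCover` with `nc = nr = 0`; `toRisered₀_riserSum` (`= 0`), `toRisered₀_tilingLoss₂`
  (`= Σ_f tentRimSharp f + Σ_k tilingRim k`);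
* `SimpleMesh cv δ` — the NON-VACUOUS mesh data over such a cover: territories, cores, prisms with designated laterals and slice excess, the collar / frontier /
  agreement / wrap / law / presentation / mass clauses (frontier material = own closure, own deep prism halves, other territories in solid agreement — no gap
  pieces, no riser boxes), with `hmass₆` only (the v3 mass clause follows);
* **`SimpleMesh.toMesh₇`** — the full `Mesh₇ cv.toRisered₀ δ`; `SimpleMesh.gapCost_toMesh₇` (`= 3·(gapArea + Σ latArea) + 13/25·Σ ex`).
-/

noncomputable section

open scoped BigOperators InnerProductSpace
open MeasureTheory

namespace Summit.Ventures.Crystal3D.Cruxes.TextureLiminf.TexShadow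

open Summit.Ventures.Crystal3D Summit.Ventures.Crystal3D.Theorems
open Literature.MathematicalPhysics.StatisticalMechanics (IsHaggSeq)

namespace CellCover

variable {C R₀ : ℝ} {N : ℕ} {x : Fin N → E3}

/-- **A tents-and-cells cover as a risered cover** (no crust cells, no riser pieces). -/
def toRisered₀ (cv : CellCover C R₀ N x) : RiseredCover C R₀ N x where
  toCellCover := cv
  nc := 0
  tf := fun c => c.elim0
  cP := fun c => c.elim0
  cB := fun c => c.elim0
  cQ := fun c => c.elim0
  cA := fun c => c.elim0
  hcP := fun c => c.elim0
  hcB := fun c => c.elim0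
  hcQ := fun c => c.elim0
  hadh := fun c => c.elim0
  hBB := fun c => c.elim0
  hBT := fun c => c.elim0
  hBC := fun c => c.elim0
  nr := 0
  rtL := fun r => r.elim0
  rtR := fun r => r.elim0
  hrt := fun r => r.elim0
  rn := fun r => r.elim0
  hrn := fun r => r.elim0
  rown := fun r => r.elim0
  hrown := fun r => r.elim0
  rV := fun r => r.elim0
  hrV6 := fun r => r.elim0
  hrplanes := fun r => r.elim0
  hrin := fun r => r.elim0
  hRR := fun r => r.elim0
  hRT := fun r => r.elim0
  hRB := fun r => r.elim0
  hRC := fun r => r.elim0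

/-- No crust cells. -/
theorem toRisered₀_nc_isEmpty (cv : CellCover C R₀ N x) : IsEmpty (Fin cv.toRisered₀.nc) := Fin.isEmpty'

/-- No riser pieces. -/
theorem toRisered₀_nr_isEmpty (cv : CellCover C R₀ N x) : IsEmpty (Fin cv.toRisered₀.nr) := Fin.isEmpty'

/-- `riserSum = 0`. -/
theorem toRisered₀_riserSum (cv : CellCover C R₀ N x) : cv.toRisered₀.riserSum = 0 := by
  haveI := toRisered₀_nr_isEmpty cv
  unfold RiseredCover.riserSum
  exact Finset.sum_of_isEmpty _

/-- `tilingLoss₂ = Σ tent sharp rims + Σ cell tiling rims`. -/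
theorem toRisered₀_tilingLoss₂ (cv : CellCover C R₀ N x) :
    cv.toRisered₀.tilingLoss₂ = ∑ f, cv.toRisered₀.tentRimSharp f + ∑ k, (cv.cell k).tilingRim := by
  haveI := toRisered₀_nc_isEmpty cv
  unfold CrustedCover.tilingLoss₂
  have h1 : ∑ c, cv.toRisered₀.crustTerm c = 0 := Finset.sum_of_isEmpty _
  have h2 : ∑ c, cv.toRisered₀.crustRim c = 0 := Finset.sum_of_isEmpty _
  rw [h1, h2]
  simp only [sub_zero, add_zero]
  rfl

end CellCover

/-! ## The non-vacuous mesh data and the full `Mesh₇` -/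

open scoped Classical in
/-- **NON-VACUOUS MESH DATA** over a tents-and-cells cover: everything `Mesh₃ … Mesh₇` ask, without the gap-piece and riser-box families (and with the v3
mass clause implied by `hmass₆`).  Frontier material: own closure, own deep prism halves, other territories in solid agreement. -/
structure SimpleMesh {C R₀ : ℝ} {N : ℕ} {x : Fin N → E3} (cv : CellCover C R₀ N x) (δ : ℝ) where
  /-- territories -/
  nD : Fin cv.ng → ℕ
  HD : (f : Fin cv.ng) → Fin (nD f) → Finset (E3 × ℝ)
  hDbd : ∀ f j, Bornology.IsBounded (polytope (HD f j))
  hDunit : ∀ f j, ∀ p ∈ HD f j, ‖p.1‖ = 1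
  desD : (f : Fin cv.ng) → Fin (nD f) → Finset (E3 × ℝ)
  hdesD : ∀ f j, desD f j ⊆ HD f j
  /-- cores -/
  nC : Fin cv.ng → ℕ
  HC : (f : Fin cv.ng) → Fin (nC f) → Finset (E3 × ℝ)
  hCbd : ∀ f j, Bornology.IsBounded (polytope (HC f j))
  hCunit : ∀ f j, ∀ p ∈ HC f j, ‖p.1‖ = 1
  hCD : ∀ f j, polytope (HC f j) ⊆ ⋃ j', polytope (HD f j')
  /-- prisms -/
  HP : Fin cv.nk → Finset (E3 × ℝ)
  hPbd : ∀ k, Bornology.IsBounded (polytope (HP k))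
  hPunit : ∀ k, ∀ p ∈ HP k, ‖p.1‖ = 1
  hPZ : ∀ k, cv.Z k ⊆ closure (polytope (HP k))
  latP : Fin cv.nk → Finset (E3 × ℝ)
  hlatP : ∀ k, latP k ⊆ HP k
  latArea : Fin cv.nk → ℝ
  hlatArea : ∀ k, ∑ p ∈ latP k, facetArea (facetOf (HP k) p) p.1 ≤ latArea k
  ex : Fin cv.nk → ℝ
  hex : ∀ k, (volume (polytope (HP k) ∩ {y | 0 ≤ cv.height k y ∧ cv.height k y ≤ 1})).toReal ≤ Real.pi * (cv.cell k).ρ ^ 2 + ex k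
  hCZ : ∀ f, ∀ y ∈ (⋃ j, polytope (HD f j)), (∃ k, Metric.infDist y (closure (polytope (HP k))) ≤ Real.sqrt 2) →
    y ∈ closure (⋃ j, polytope (HC f j))
  hU : ∀ f, (cv.tent f).U = (⋃ j, polytope (HD f j)) \ closure (⋃ j, polytope (HC f j))
  hcollar₃ : ∀ f, ∀ z ∈ (cv.tent f).U, Metric.infDist z (⋃ j, polytope (HC f j)) < 1 → cv.SolidAt f z
  /-- cells ↔ grains -/
  fk : Fin cv.nk → Fin cv.ng
  gk : Fin cv.nk → Fin cv.ng
  hfg : ∀ k, fk k ≠ gk k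
  /-- territory frontier: EMPTY off the core, DESIGNATED, or solid with own material / deep prism halves / another territory in agreement across -/
  hbdry : ∀ f, ∀ y ∈ frontier (⋃ j, polytope (HD f j)),
    (cv.EmptyAt f y ∧ y ∉ closure (⋃ j, polytope (HC f j))) ∨ (∃ j, ∃ p ∈ desD f j, y ∈ facetOf (HD f j) p) ∨
      ∃ r : ℝ, 0 < r ∧ (∀ z ∈ Metric.ball y r, z ∈ (cv.tent f).U → cv.SolidAt f z) ∧
        Metric.ball y r ⊆ closure (⋃ j, polytope (HD f j)) ∪
          ((⋃ k ∈ (Finset.univ.filter fun k => fk k = f), (closure (polytope (HP k)) ∩ {z | cv.height k z ≤ -1})) ∪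
            (⋃ k ∈ (Finset.univ.filter fun k => gk k = f), (closure (polytope (HP k)) ∩ {z | (cv.cell k).h + 1 ≤ cv.height k z})) ∪
            (⋃ g ∈ (Finset.univ.filter fun g => g ≠ f), {z | z ∈ closure (⋃ j, polytope (HD g j)) ∧
              (z ∈ (cv.tent g).U → cv.SolidAt g z) ∧
              ∃ r' : ℝ, 0 < r' ∧ cv.S f ∩ Metric.ball z (r' + 4) = cv.S g ∩ Metric.ball z (r' + 4)}))
  hS₁ : ∀ k, rigid (cv.cell k).M (cv.cell k).t '' stacking (cv.cell k).L₁ (cv.cell k).s₁ (cv.cell k).σ₁ = cv.S (fk k)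
  hS₂ : ∀ k, rigid (cv.cell k).M (cv.cell k).t '' stacking (cv.cell k).L₂ (cv.cell k).s₂ (cv.cell k).σ₂ = cv.S (gk k)
  hDD : ∀ f g, f ≠ g → Disjoint (⋃ j, polytope (HD f j)) (⋃ j, polytope (HD g j))
  hDP : ∀ f k, Disjoint (⋃ j, polytope (HD f j)) (polytope (HP k))
  hPP : ∀ k k', k ≠ k' → Disjoint (polytope (HP k)) (polytope (HP k'))
  hside₁ : ∀ k, ∀ y ∈ closure (⋃ j, polytope (HD (fk k) j)) ∩ closure (polytope (HP k)), cv.height k y ≤ -R₀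
  hside₂ : ∀ k, ∀ y ∈ closure (⋃ j, polytope (HD (gk k) j)) ∩ closure (polytope (HP k)), (cv.cell k).h + R₀ ≤ cv.height k y
  hside₀ : ∀ k f, f ≠ fk k → f ≠ gk k → Disjoint (closure (⋃ j, polytope (HD f j))) (closure (polytope (HP k)))
  hagree : ∀ f g, f ≠ g → ∀ y ∈ closure (⋃ j, polytope (HD f j)) ∩ closure (⋃ j, polytope (HD g j)),
    ∃ r : ℝ, 0 < r ∧ (∀ z ∈ Metric.ball y r, (z ∈ (cv.tent f).U → cv.SolidAt f z) ∧ (z ∈ (cv.tent g).U → cv.SolidAt g z)) ∧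
      cv.S f ∩ Metric.ball y (r + 4) = cv.S g ∩ Metric.ball y (r + 4)
  hwrap₁ : ∀ k, ∀ y ∈ closure (polytope (HP k)), cv.height k y ≤ -R₀ → ∃ r : ℝ, 0 < r ∧
    Metric.ball y r ⊆ closure (polytope (HP k)) ∪ {z | z ∈ closure (⋃ j, polytope (HD (fk k) j)) ∧ (z ∈ (cv.tent (fk k)).U → cv.SolidAt (fk k) z)}
  hwrap₂ : ∀ k, ∀ y ∈ closure (polytope (HP k)), (cv.cell k).h + R₀ ≤ cv.height k y → ∃ r : ℝ, 0 < r ∧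
    Metric.ball y r ⊆ closure (polytope (HP k)) ∪ {z | z ∈ closure (⋃ j, polytope (HD (gk k) j)) ∧ (z ∈ (cv.tent (gk k)).U → cv.SolidAt (gk k) z)}
  hlaw : ∀ k i j, (¬ CoAx ((cv.cell k).A₁ i) ((cv.cell k).A₂ j) → (13 / 25 : ℝ) ≤ (cv.cell k).c i j) ∧
    (CoAx ((cv.cell k).A₁ i) ((cv.cell k).A₂ j) → (cv.cell k).A₁ i '' fccRef ≠ (cv.cell k).A₂ j '' fccRef →
      1 / 2 * Real.sqrt (1 - ⟪(cv.cell k).m i j, e₃⟫_ℝ ^ 2) ≤ (cv.cell k).c i j)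
  /-- designated-area budget -/
  gapArea : ℝ
  hgapArea : (∑ f, ∑ j, ∑ p ∈ desD f j, facetArea (facetOf (HD f j) p) p.1) ≤ gapArea
  /-- v4/v5 clauses -/
  hpres₁ : ∀ k, (∀ r : E3, rigid (cv.cell k).M (cv.cell k).t ((cv.cell k).L₁ r + (cv.cell k).s₁) =
      (cv.tent (fk k)).L r + (cv.tent (fk k)).s) ∧ (cv.cell k).σ₁ = (cv.tent (fk k)).σ
  hpres₂ : ∀ k, (∀ r : E3, rigid (cv.cell k).M (cv.cell k).t ((cv.cell k).L₂ r + (cv.cell k).s₂) =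
      (cv.tent (gk k)).L r + (cv.tent (gk k)).s) ∧ (cv.cell k).σ₂ = (cv.tent (gk k)).σ
  hagreeFr : ∀ f g, f ≠ g → ∀ y ∈ closure (⋃ j, polytope (HD f j)) ∩ closure (⋃ j, polytope (HD g j)),
    ∃ r : ℝ, 0 < r ∧ cv.S f ∩ Metric.ball y (r + 4) = cv.S g ∩ Metric.ball y (r + 4) ∧
      (((cv.tent f).L e₃ = (cv.tent g).L e₃ ∨ (cv.tent f).L e₃ = -(cv.tent g).L e₃) ∨
        ∃ (A : E3 ≃ₗᵢ[ℝ] E3) (u : E3), cv.S f ∩ Metric.ball y (r + 4) ⊆ (fun q => A q + u) '' fccRef)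
  hmatchFr : ∀ f g, f ≠ g → ∀ z ∈ closure (⋃ j, polytope (HD g j)), ∀ r' : ℝ, 0 < r' →
    cv.S f ∩ Metric.ball z (r' + 4) = cv.S g ∩ Metric.ball z (r' + 4) →
      (((cv.tent f).L e₃ = (cv.tent g).L e₃ ∨ (cv.tent f).L e₃ = -(cv.tent g).L e₃) ∨
        ∃ (A : E3 ≃ₗᵢ[ℝ] E3) (u : E3), cv.S f ∩ Metric.ball z (r' + 4) ⊆ (fun q => A q + u) '' fccRef)
  hPlat : ∀ k, ∀ p ∈ HP k \ latP k, ∀ y ∈ facetOf (HP k) p, cv.height k y ≤ -R₀ ∨ (cv.cell k).h + R₀ ≤ cv.height k y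
  /-- the real-complete mass clause (v6) -/
  hmass₆ : (1 - δ) * (N : ℝ) ≤
    ((Finset.univ.filter fun i : Fin cv.N' => ∃ f,
      ((cv.x' i ∈ cv.S f ∧ ∀ b ∈ cv.S f, dist (cv.x' i) b ≤ 2 * Real.sqrt 2 → b ∈ (cv.tent f).Xh ∧ b ∈ cv.X') ∨
        (Disjoint (Metric.closedBall (cv.x' i) (Real.sqrt 2)) (cv.tent f).U ∧ cv.LocPerfect (cv.x' i))) ∧
      Metric.closedBall (cv.x' i) (Real.sqrt 2) ⊆ (⋃ j, polytope (HD f j)) ∪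
        (⋃ k ∈ (Finset.univ.filter fun k => fk k = f), (closure (polytope (HP k)) ∩ {z | cv.height k z ≤ -1})) ∪
        (⋃ k ∈ (Finset.univ.filter fun k => gk k = f), (closure (polytope (HP k)) ∩ {z | (cv.cell k).h + 1 ≤ cv.height k z}))).card : ℝ)

namespace SimpleMesh

variable {C R₀ : ℝ} {N : ℕ} {x : Fin N → E3} {cv : CellCover C R₀ N x} {δ : ℝ}

open scoped Classical in
/-- The v6 mass clause implies the v3 one (real-complete ⇒ tent-deep). -/
theorem hmass₃ (sm : SimpleMesh cv δ) : (1 - δ) * (N : ℝ) ≤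
    ((Finset.univ.filter fun i : Fin cv.N' => ∃ f,
      (cv.DeepAt f (cv.x' i) ∨ (Disjoint (Metric.closedBall (cv.x' i) (Real.sqrt 2)) (cv.tent f).U ∧ cv.LocPerfect (cv.x' i))) ∧
      Metric.closedBall (cv.x' i) (Real.sqrt 2) ⊆ (⋃ j, polytope (sm.HD f j)) ∪
        (⋃ k ∈ (Finset.univ.filter fun k => sm.fk k = f), (closure (polytope (sm.HP k)) ∩ {z | cv.height k z ≤ -1})) ∪
        (⋃ k ∈ (Finset.univ.filter fun k => sm.gk k = f), (closure (polytope (sm.HP k)) ∩ {z | (cv.cell k).h + 1 ≤ cv.height k z}))).card : ℝ) := by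
  refine le_trans sm.hmass₆ ?_
  exact_mod_cast Finset.card_le_card fun i hi => by
    obtain ⟨f, hf, hsub⟩ := (Finset.mem_filter.1 hi).2
    refine Finset.mem_filter.2 ⟨Finset.mem_univ _, f, ?_, hsub⟩
    rcases hf with ⟨-, hdeep⟩ | hloc
    · exact Or.inl fun b hb hd => (hdeep b hb hd).1
    · exact Or.inr hloc

open scoped Classical in
/-- **THE FULL v7 MESH from the non-vacuous data.** -/
def toMesh₇ (sm : SimpleMesh cv δ) : Mesh₇ cv.toRisered₀ δ where
  nD := sm.nD
  HD := sm.HD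
  hDbd := sm.hDbd
  hDunit := sm.hDunit
  desD := sm.desD
  hdesD := sm.hdesD
  nC := sm.nC
  HC := sm.HC
  hCbd := sm.hCbd
  hCunit := sm.hCunit
  hCD := sm.hCD
  HP := sm.HP
  hPbd := sm.hPbd
  hPunit := sm.hPunit
  hPZ := sm.hPZ
  latP := sm.latP
  hlatP := sm.hlatP
  latArea := sm.latArea
  hlatArea := sm.hlatArea
  ex := sm.ex
  hex := sm.hex
  hCZ := sm.hCZ
  hU := sm.hU
  hcollar₃ := sm.hcollar₃
  fk := sm.fk
  gk := sm.gk
  hfg := sm.hfg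
  nQ := 0
  HQ := fun l => l.elim0
  lab := fun l => l.elim0
  HB := fun r => r.elim0
  hBbd := fun r => r.elim0
  hBunit := fun r => r.elim0
  desB := fun r => r.elim0
  hdesB := fun r => r.elim0
  hbdry := by
    intro f y hy
    rcases sm.hbdry f y hy with h | h | ⟨r, hr, hsol, hsub⟩
    · exact Or.inl h
    · exact Or.inr (Or.inl h)
    · refine Or.inr (Or.inr ⟨r, hr, hsol, fun z hz => ?_⟩)
      rcases hsub hz with h1 | ((h2 | h3) | h4)
      · exact Or.inl h1
      · exact Or.inr (Or.inl (Or.inl (Or.inl (Or.inl h2))))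
      · exact Or.inr (Or.inl (Or.inl (Or.inl (Or.inr h3))))
      · exact Or.inr (Or.inr h4)
  hS₁ := sm.hS₁
  hS₂ := sm.hS₂
  hDD := sm.hDD
  hDP := sm.hDP
  hPP := sm.hPP
  hside₁ := sm.hside₁
  hside₂ := sm.hside₂
  hside₀ := sm.hside₀
  hagree := sm.hagree
  hwrap₁ := sm.hwrap₁
  hwrap₂ := sm.hwrap₂
  hlaw := sm.hlaw
  hQbd := fun l => l.elim0
  hQunit := fun l => l.elim0
  hQD := fun l => l.elim0
  hQP := fun l => l.elim0
  hQQ := fun l => l.elim0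
  hBD := fun r => r.elim0
  hBP := fun r => r.elim0
  hBQ := fun r => r.elim0
  hBB := fun r => r.elim0
  hframe := fun r => r.elim0
  hBclean := fun r => r.elim0
  hBown := fun r => r.elim0
  hBV := fun r => r.elim0
  hBmatch := fun r => r.elim0
  desQ := fun l => l.elim0
  hdesQ := fun l => l.elim0
  hQmatch := fun l => l.elim0
  gapArea := sm.gapArea
  hgapArea := by
    haveI : IsEmpty (Fin cv.toRisered₀.nr) := CellCover.toRisered₀_nr_isEmpty cv
    simp only [Finset.univ_eq_empty, Finset.sum_empty, zero_add, add_zero]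
    exact sm.hgapArea
  hmass := sm.hmass₃
  hpres₁ := sm.hpres₁
  hpres₂ := sm.hpres₂
  hagreeFr := sm.hagreeFr
  hmatchFr := sm.hmatchFr
  hPlat := sm.hPlat
  hQmatch₅ := fun l => l.elim0
  hBmatch₅ := fun r => r.elim0
  hBown₅ := fun r => r.elim0
  hBhalo := fun r => r.elim0
  hmass₆ := sm.hmass₆
  hBownRn := fun r => r.elim0

/-- The gap cost of the built mesh. -/
theorem gapCost_toMesh₇ (sm : SimpleMesh cv δ) :
    sm.toMesh₇.gapCost = 3 * (sm.gapArea + ∑ k, sm.latArea k) + 13 / 25 * ∑ k, sm.ex k := rfl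

end SimpleMesh

end Summit.Ventures.Crystal3D.Cruxes.TextureLiminf.TexShadow

end
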